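import Literature.Analysis.FluidPDE.PassiveScalarForcedClass
import HarnessLib

/-!
# Route LimitingAbsorption — `RelaxationBoundsInventory`, I: time shifts of weak scalars

Support lemmas for item stmt-AnomalousDissipation-2940 (`RelaxationBoundsInventory`, route
`route-AnomalousDissipation-LimitingAbsorption`): the Duhamel superposition of homogeneous
passive scalars released at phases `a ≥ 0` needs the elementary bookkeeping of TIME SHIFTS in
the distributional class `Torus.IsWeakScalarTransportOn` (DiPerna–Lions 1989, §II.1):

* translations `τ ↦ a + τ` / `t ↦ t - a` are measure preserving between `(0, T - a)` and
  `(a, T)`, also on space–time products (`measurePreserving_const_add_Ioo`, `…_prod`);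
* a space–time test function on `[0, T)` shifted back by `a ≥ 0` is a test function on
  `[0, T - a)` (`isSpaceTimeTest_comp_const_add`), with the shifted time derivative;
* an essentially bounded drift stays essentially bounded after the shift
  (`memLp_top_stLift_comp_const_add`), a.e.-in-time properties shift (`ae_restrict_Ioo_comp_const_add`);
* the RELEASE at phase `a` of a weak solution `Θ` on `[0, T - a)` with the shifted drift
  `u(a + ·)` — the field `Λ(t, x) = Θ(t - a, x)` for `t > a`, `0` for `t ≤ a` — is measurable on
  `(0,T) × T^d`, inherits slice-wise properties, and pairs with the weak-form integrand of any
  test function `ψ` on `[0,T)` to `-∫ h ψ(a)` (`integral_release_mul_weakIntegrand`): the weak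
  identity of `Θ` tested with `ψ(a + ·)`.

## References

* R. J. DiPerna, P.-L. Lions, Invent. Math. 98 (1989), §II.1. [`DiPernaLions1989`]
* A. Pazy, *Semigroups of Linear Operators and Applications to PDE* (Springer 1983), Ch. 5,
  §5.1–5.2 (evolution systems `U(t,s)`, mild solutions of the inhomogeneous problem). [`Pazy1983`]
-/

noncomputable section

open MeasureTheory Set Filter Function TopologicalSpace
open scoped ENNReal NNReal InnerProductSpace

namespace Summit.AnomalousDissipation.AnomalousDissipation.Theorems

-- D-0017: single-problem summit ⇒ `Summit.AnomalousDissipation.AnomalousDissipation.…` by design.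
set_option linter.dupNamespace false

namespace LapInventory

open Literature.Analysis Literature.Analysis.FluidPDE Literature.Analysis.FluidPDE.Torus

variable {d : Type*} [Fintype d]

/-! ## Translations in time -/

/-- `τ ↦ a + τ` maps Lebesgue measure on `(0, T - a)` to Lebesgue measure on `(a, T)`. [folklore] -/
theorem measurePreserving_const_add_Ioo (a T : ℝ) :
    MeasurePreserving (fun τ : ℝ => a + τ) ((volume : Measure ℝ).restrict (Ioo 0 (T - a)))
      ((volume : Measure ℝ).restrict (Ioo a T)) := by
  have h := (measurePreserving_add_left (volume : Measure ℝ) a).restrict_preimage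
    (measurableSet_Ioo (a := a) (b := T))
  have e : (fun τ : ℝ => a + τ) ⁻¹' Ioo a T = Ioo 0 (T - a) := by
    rw [Set.preimage_const_add_Ioo, sub_self]
  rwa [e] at h

/-- `t ↦ t - a` maps Lebesgue measure on `(a, T)` to Lebesgue measure on `(0, T - a)`. [folklore] -/
theorem measurePreserving_sub_const_Ioo (a T : ℝ) :
    MeasurePreserving (fun t : ℝ => t - a) ((volume : Measure ℝ).restrict (Ioo a T))
      ((volume : Measure ℝ).restrict (Ioo 0 (T - a))) := by
  have h := (measurePreserving_sub_right (volume : Measure ℝ) a).restrict_preimage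
    (measurableSet_Ioo (a := (0 : ℝ)) (b := T - a))
  have e : (fun t : ℝ => t - a) ⁻¹' Ioo 0 (T - a) = Ioo a T := by
    rw [Set.preimage_sub_const_Ioo, zero_add, sub_add_cancel]
  rwa [e] at h

/-- Product form of `measurePreserving_const_add_Ioo`: `(τ, y) ↦ (a + τ, y)` maps
`vol|_{(0,T-a) × X}` to `vol|_{(a,T) × X}`. [folklore] -/
theorem measurePreserving_const_add_Ioo_prod {X : Type*} [MeasureSpace X]
    [SFinite (volume : Measure X)] (a T : ℝ) :
    MeasurePreserving (fun p : ℝ × X => (a + p.1, p.2))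
      (volume.restrict (Ioo 0 (T - a) ×ˢ (univ : Set X))) (volume.restrict (Ioo a T ×ˢ (univ : Set X))) := by
  rw [Measure.volume_eq_prod, ← Measure.prod_restrict, ← Measure.prod_restrict, Measure.restrict_univ]
  exact (measurePreserving_const_add_Ioo a T).prod (MeasurePreserving.id _)

/-- Product form of `measurePreserving_sub_const_Ioo` for the product measure
`(vol|_{(a,T)}) ⊗ vol → (vol|_{(0,T-a)}) ⊗ vol`. [folklore] -/
theorem measurePreserving_sub_const_Ioo_prod {X : Type*} [MeasureSpace X]
    [SFinite (volume : Measure X)] (a T : ℝ) :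
    MeasurePreserving (fun p : ℝ × X => (p.1 - a, p.2))
      (((volume : Measure ℝ).restrict (Ioo a T)).prod (volume : Measure X))
      (((volume : Measure ℝ).restrict (Ioo 0 (T - a))).prod (volume : Measure X)) :=
  (measurePreserving_sub_const_Ioo a T).prod (MeasurePreserving.id _)

/-- A.e.-in-time statements on `(0,T)` shift to `(0, T - a)` along `τ ↦ a + τ`, `a ≥ 0`. [folklore] -/
theorem ae_restrict_Ioo_comp_const_add {a T : ℝ} (ha : 0 ≤ a) {P : ℝ → Prop}
    (h : ∀ᵐ t ∂((volume : Measure ℝ).restrict (Ioo 0 T)), P t) :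
    ∀ᵐ τ ∂((volume : Measure ℝ).restrict (Ioo 0 (T - a))), P (a + τ) := by
  have h' : ∀ᵐ t ∂((volume : Measure ℝ).restrict (Ioo a T)), P t :=
    ae_restrict_of_ae_restrict_of_subset (Ioo_subset_Ioo_left ha) h
  exact (measurePreserving_const_add_Ioo a T).quasiMeasurePreserving.ae h'

/-! ## Shifted test functions and drifts -/

/-- **Shifted test functions.** If `ψ` is a space–time test function on `[0,T)` and `a ≥ 0`,
then `(τ, x) ↦ ψ(a + τ, x)` is a space–time test function on `[0, T - a)`. [folklore] -/
theorem isSpaceTimeTest_comp_const_add {T a : ℝ} {ψ : ℝ → UnitAddTorus d → ℝ}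
    (hψ : FunctionSpaces.Torus.IsSpaceTimeTest T ψ) :
    FunctionSpaces.Torus.IsSpaceTimeTest (T - a) (fun τ x => ψ (a + τ) x) := by
  obtain ⟨hs, T', hT', h0⟩ := hψ
  refine ⟨?_, T' - a, by linarith, fun τ hτ => ?_⟩
  · have e : FunctionSpaces.Torus.stLift (fun τ x => ψ (a + τ) x) =
        FunctionSpaces.Torus.stLift ψ ∘ fun p : ℝ × EuclideanSpace ℝ d => (a + p.1, p.2) := by
      funext p; rfl
    rw [e]
    exact hs.comp ((contDiff_const.add contDiff_fst).prodMk contDiff_snd)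
  · funext x
    have : T' ≤ a + τ := by linarith
    show ψ (a + τ) x = 0
    rw [h0 (a + τ) this, Pi.zero_apply]

omit [Fintype d] in
/-- The time derivative of the shifted test function is the shifted time derivative. [folklore] -/
theorem timeDeriv_comp_const_add (ψ : ℝ → UnitAddTorus d → ℝ) (a τ : ℝ) (x : UnitAddTorus d) :
    FunctionSpaces.Torus.timeDeriv (fun τ x => ψ (a + τ) x) τ x = FunctionSpaces.Torus.timeDeriv ψ (a + τ) x := by
  unfold FunctionSpaces.Torus.timeDeriv
  exact deriv_comp_const_add (fun s => ψ s x) a τ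

/-- **Shifted drifts stay essentially bounded**: if `u ∈ L^∞((0,T) × T^d)` (space–time lift)
and `a ≥ 0`, then `u(a + ·) ∈ L^∞((0,T-a) × T^d)`. [folklore] -/
theorem memLp_top_stLift_comp_const_add {u : ℝ → UnitAddTorus d → EuclideanSpace ℝ d} {a T : ℝ}
    (ha : 0 ≤ a) (hu : MemLp (FunctionSpaces.Torus.stLift u) ⊤ (volume.restrict (Ioo 0 T ×ˢ univ))) :
    MemLp (FunctionSpaces.Torus.stLift (fun t => u (a + t))) ⊤ (volume.restrict (Ioo 0 (T - a) ×ˢ univ)) := by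
  have hmono : volume.restrict (Ioo a T ×ˢ (univ : Set (EuclideanSpace ℝ d))) ≤
      volume.restrict (Ioo 0 T ×ˢ univ) :=
    Measure.restrict_mono (prod_mono (Ioo_subset_Ioo_left ha) le_rfl) le_rfl
  exact (hu.mono_measure hmono).comp_measurePreserving (measurePreserving_const_add_Ioo_prod a T)

/-! ## The release of a weak solution at phase `a` -/

section Release

variable {T a : ℝ} {Θ : ℝ → UnitAddTorus d → ℝ}

/-- **Measurability of the release.** If `Θ` is measurable on `(0, T - a) × T^d`, then the field
released at phase `a ≥ 0`, `(t, x) ↦ Θ(t - a, x)` for `t > a` and `0` for `t ≤ a`, is measurable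
on `(0,T) × T^d`. [folklore] -/
theorem aestronglyMeasurable_uncurry_release (ha : 0 ≤ a)
    (hΘ : AEStronglyMeasurable (uncurry Θ)
      (((volume : Measure ℝ).restrict (Ioo 0 (T - a))).prod (volume : Measure (UnitAddTorus d)))) :
    AEStronglyMeasurable (uncurry fun t x => if a < t then Θ (t - a) x else 0)
      (((volume : Measure ℝ).restrict (Ioo 0 T)).prod (volume : Measure (UnitAddTorus d))) := by
  have e : (uncurry fun t x => if a < t then Θ (t - a) x else 0) =
      (Ioi a ×ˢ (univ : Set (UnitAddTorus d))).indicator (fun p : ℝ × UnitAddTorus d => Θ (p.1 - a) p.2) := by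
    funext p
    by_cases hp : a < p.1
    · rw [indicator_of_mem (show p ∈ Ioi a ×ˢ univ from ⟨hp, mem_univ _⟩)]
      simp [uncurry, hp]
    · rw [indicator_of_notMem (show p ∉ Ioi a ×ˢ univ from fun h => hp h.1)]
      simp [uncurry, hp]
  rw [e, aestronglyMeasurable_indicator_iff (measurableSet_Ioi.prod MeasurableSet.univ)]
  have hμ : (((volume : Measure ℝ).restrict (Ioo 0 T)).prod (volume : Measure (UnitAddTorus d))).restrict
      (Ioi a ×ˢ univ) = ((volume : Measure ℝ).restrict (Ioo a T)).prod (volume : Measure (UnitAddTorus d)) := by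
    rw [← Measure.prod_restrict, Measure.restrict_univ, Measure.restrict_restrict measurableSet_Ioi]
    congr 2
    ext t
    simp only [mem_inter_iff, mem_Ioi, mem_Ioo]
    constructor
    · rintro ⟨h1, -, h3⟩; exact ⟨h1, h3⟩
    · rintro ⟨h1, h2⟩; exact ⟨h1, ha.trans_lt h1, h2⟩
  rw [hμ]
  have hmono : ((volume : Measure ℝ).restrict (Ioo 0 (T - a))).prod (volume : Measure (UnitAddTorus d)) ≤
      ((volume : Measure ℝ).restrict (Ioo 0 (T - a))).prod (volume : Measure (UnitAddTorus d)) := le_rfl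
  exact (hΘ.mono_measure hmono).comp_measurePreserving (measurePreserving_sub_const_Ioo_prod a T)

omit [Fintype d] in
/-- **Slice-wise properties of the release.** If a property `R t φ` of a time and a field holds
for `φ = Θ(τ)` at time `t = a + τ` for a.e. `τ ∈ (0, T - a)`, and for the zero field at every time
`t ≤ a`, then it holds for the slices of the release for a.e. `t ∈ (0, T)`. [folklore] -/
theorem ae_release_slice {R : ℝ → (UnitAddTorus d → ℝ) → Prop}
    (hR : ∀ᵐ τ ∂((volume : Measure ℝ).restrict (Ioo 0 (T - a))), R (a + τ) (Θ τ))
    (h0 : ∀ t, t ≤ a → R t fun _ => 0) :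
    ∀ᵐ t ∂((volume : Measure ℝ).restrict (Ioo 0 T)),
      R t (fun x => if a < t then Θ (t - a) x else 0) := by
  have h1 : ∀ᵐ t ∂((volume : Measure ℝ).restrict (Ioo a T)), R (a + (t - a)) (Θ (t - a)) :=
    (measurePreserving_sub_const_Ioo a T).quasiMeasurePreserving.ae hR
  have h2 : ∀ᵐ t ∂(volume : Measure ℝ), t ∈ Ioo a T → R t (Θ (t - a)) := by
    rw [← ae_restrict_iff' measurableSet_Ioo]
    filter_upwards [h1] with t ht
    rwa [add_sub_cancel] at ht
  have h3 : ∀ᵐ t ∂((volume : Measure ℝ).restrict (Ioo 0 T)), t ∈ Ioo a T → R t (Θ (t - a)) :=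
    ae_restrict_of_ae h2
  filter_upwards [h3, ae_restrict_mem measurableSet_Ioo] with t ht htT
  by_cases hat : a < t
  · have e : (fun x => if a < t then Θ (t - a) x else 0) = Θ (t - a) := by
      funext x; rw [if_pos hat]
    rw [e]
    exact ht ⟨hat, htT.2⟩
  · have e : (fun x => if a < t then Θ (t - a) x else 0) = fun _ => (0 : ℝ) := by
      funext x; rw [if_neg hat]
    rw [e]
    exact h0 t (not_lt.1 hat)

variable {κ : ℝ} {u : ℝ → UnitAddTorus d → EuclideanSpace ℝ d} {h : UnitAddTorus d → ℝ}
  {ψ : ℝ → UnitAddTorus d → ℝ}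

/-- **The release tested against a weak-form integrand.** Let `Θ` be a weak solution of the
homogeneous passive scalar equation on `[0, T - a)` with the shifted drift `u(a + ·)` and datum
`h`, `0 ≤ a`, and let `ψ` be a space–time test function on `[0,T)`. Then the release `Λ` of `Θ`
at phase `a` satisfies `∫₀ᵀ ∫ Λ (∂ₜψ + u·∇ψ + κΔψ) = -∫ h ψ(a)`: after the change of variables
`t = a + τ` this is the weak identity of `Θ` tested with `ψ(a + ·)` (a test function on
`[0, T - a)`). This is the distributional form of "`U(t,a)h` solves the homogeneous equation for
`t > a` with datum `h` at `t = a`" (Pazy 1983, Ch. 5, §5.1). [cite: DiPernaLions1989, §II.1] -/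
theorem integral_release_mul_weakIntegrand (ha : 0 ≤ a)
    (hΘ : IsWeakScalarTransportOn (T - a) κ (fun t => u (a + t)) h Θ)
    (hψ : FunctionSpaces.Torus.IsSpaceTimeTest T ψ) :
    (∫ t in Ioo 0 T, ∫ x, (if a < t then Θ (t - a) x else 0) *
        (FunctionSpaces.Torus.timeDeriv ψ t x + ⟪u t x, FunctionSpaces.Torus.gradient (ψ t) x⟫_ℝ +
          κ * FunctionSpaces.Torus.laplacian (ψ t) x)) = -∫ x, h x * ψ a x := by
  -- the weak-form integrand of `ψ` and the space integral of the shifted solution against it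
  set G : ℝ → UnitAddTorus d → ℝ := fun t x =>
    FunctionSpaces.Torus.timeDeriv ψ t x + ⟪u t x, FunctionSpaces.Torus.gradient (ψ t) x⟫_ℝ +
      κ * FunctionSpaces.Torus.laplacian (ψ t) x with hG
  set F : ℝ → ℝ := fun t => ∫ x, Θ (t - a) x * G t x with hF
  -- (1) the space integral is the indicator of `t > a` times `F`
  have h1 : (fun t => ∫ x, (if a < t then Θ (t - a) x else 0) * G t x) = (Ioi a).indicator F := by
    funext t
    by_cases hat : a < t
    · rw [indicator_of_mem (mem_Ioi.2 hat), hF]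
      simp only [if_pos hat]
    · rw [indicator_of_notMem (fun h : t ∈ Ioi a => hat h)]
      simp only [if_neg hat, zero_mul, integral_zero]
  change (∫ t in Ioo 0 T, (fun t => ∫ x, (if a < t then Θ (t - a) x else 0) * G t x) t) = _
  rw [h1, setIntegral_indicator measurableSet_Ioi]
  have hI : Ioo 0 T ∩ Ioi a = Ioo a T := by
    ext t
    simp only [mem_inter_iff, mem_Ioo, mem_Ioi]
    constructor
    · rintro ⟨⟨-, h2⟩, h3⟩; exact ⟨h3, h2⟩
    · rintro ⟨h1, h2⟩; exact ⟨⟨ha.trans_lt h1, h2⟩, h1⟩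
  rw [hI]
  -- (2) change of variables `t = a + τ`
  have h2 : (∫ t in Ioo a T, F t) = ∫ τ in Ioo 0 (T - a), F (a + τ) := by
    have hmp : MeasurePreserving (fun τ : ℝ => a + τ) (volume : Measure ℝ) volume :=
      measurePreserving_add_left volume a
    have hemb : MeasurableEmbedding (fun τ : ℝ => a + τ) := (MeasurableEquiv.addLeft a).measurableEmbedding
    have h := hmp.setIntegral_preimage_emb hemb F (Ioo a T)
    rw [Set.preimage_const_add_Ioo, sub_self] at h
    exact h.symm
  rw [h2]
  -- (3) the shifted integrand is the weak-form integrand of the shifted test function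
  have h3 : ∀ τ, F (a + τ) = ∫ x, Θ τ x *
      (FunctionSpaces.Torus.timeDeriv (fun τ x => ψ (a + τ) x) τ x +
        ⟪u (a + τ) x, FunctionSpaces.Torus.gradient ((fun τ x => ψ (a + τ) x) τ) x⟫_ℝ +
        κ * FunctionSpaces.Torus.laplacian ((fun τ x => ψ (a + τ) x) τ) x) := by
    intro τ
    rw [hF]
    simp only [add_sub_cancel_left, hG, timeDeriv_comp_const_add]
  simp_rw [h3]
  -- (4) the weak identity of `Θ` tested with `ψ(a + ·)`
  have h4 := hΘ.weak_eq (fun τ x => ψ (a + τ) x) (isSpaceTimeTest_comp_const_add hψ)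
  simp only [add_zero] at h4
  linarith

end Release

/-! ## Integrability of `L^∞_t L²_x` fields on `(0,T) × T^d` -/

/-- A measurable space–time field with `‖F(t)‖_{L²} ≤ B < ∞` for a.e. `t ∈ (0,T)` is integrable
on `(0,T) × T^d` (`L^∞_t L²_x ⊂ L¹_{t,x}` on the probability space `T^d`, `T` finite). [folklore] -/
theorem integrable_uncurry_of_ae_eLpNorm_le {T : ℝ} {F : ℝ → UnitAddTorus d → ℝ} {B : ℝ≥0∞}
    (hB : B ≠ ⊤)
    (hm : AEStronglyMeasurable (uncurry F)
      (((volume : Measure ℝ).restrict (Ioo 0 T)).prod (volume : Measure (UnitAddTorus d))))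
    (hb : ∀ᵐ t ∂((volume : Measure ℝ).restrict (Ioo 0 T)), eLpNorm (F t) 2 volume ≤ B) :
    Integrable (uncurry F) (((volume : Measure ℝ).restrict (Ioo 0 T)).prod (volume : Measure (UnitAddTorus d))) := by
  refine ⟨hm, ?_⟩
  rw [hasFiniteIntegral_iff_enorm, lintegral_prod _ hm.enorm]
  calc ∫⁻ t in Ioo 0 T, ∫⁻ x, ‖uncurry F (t, x)‖ₑ
      ≤ ∫⁻ _ in Ioo 0 T, B := by
        refine lintegral_mono_ae ?_
        filter_upwards [hb, hm.prodMk_left] with t ht htm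
        calc ∫⁻ x, ‖uncurry F (t, x)‖ₑ = eLpNorm (F t) 1 volume := by
              rw [eLpNorm_one_eq_lintegral_enorm]; rfl
          _ ≤ eLpNorm (F t) 2 volume := eLpNorm_le_eLpNorm_of_exponent_le (by norm_num) htm
          _ ≤ B := ht
    _ < ⊤ := by
        rw [setLIntegral_const]
        exact ENNReal.mul_lt_top hB.lt_top measure_Ioo_lt_top

end LapInventory

end Summit.AnomalousDissipation.AnomalousDissipation.Theorems

end
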